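import Literature.AnabelianGeometry.EtaleTheta.Thm16SubdagCapstone
import Literature.AnabelianGeometry.EtaleTheta.ThetaCohomologyInversion
import Literature.AnabelianGeometry.EtaleTheta.ThetaCohomologyZHatLog
import HarnessLib

/-!
# [EtTh] Thm. 1.6 (iii): the inversion rows of the K3 capstone FROM THE ROOT PREDICATES of Prop. 1.5 (ii)(iii)
# (proof-only)

Mochizuki, *The étale theta function and its Frobenioid-theoretic manifestations*, Publ. RIMS **45** (2009),
Thm. 1.6 (iii) pp. 24–25 (printed 250–251), proof p. 25 l. 15–38; Prop. 1.5 (ii)(iii) p. 23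
[cite: MochizukiEtTh2009, Thm 1.6 (iii) p.25]. abc-iut cell, layer L2, seat abc-iut-L2-t1 (§1 ROOT owner).
PROOF-ONLY companion (0 `def`, 0 new `Prop`) of abc-iut-L6-d5's sub-DAG capstone
`Thm16Sub.thm16iii_of_printedClauses` (`Thm16SubdagCapstone.lean`, K3 part 7), whose inversion rows L12/L14-ι are
print-shaped BINDERS (`ι`, `hιF1`, `hιx`, `hιy`) and whose row «F̈¹/F̈² ≅ Ẑ·log(Ü)» is the binder `htf`. Here those
binders are SUPPLIED from the root typings of the two previously untyped clauses of Prop. 1.5 —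
`ThetaSetting.IsInversionAut` / `InvClauses` / `InvNegatesFdd1Quot` (`ThetaCohomologyInversion.lean`) and
`ThetaSetting.Prop15iiQuot` (`ThetaCohomologyZHatLog.lean`) — plus the ONE printed compatibility clause of the
proof of Thm. 1.6 (iii): «By composing γ with an appropriate inner automorphism of Π^tp_{Xβ}, it follows from
[SemiAnbd], Theorem 6.8, (ii), that we may assume that the isomorphism Π^tp_{Ÿα} ⥲ Π^tp_{Ÿβ} is compatible with
suitable “inversion automorphisms” ια, ιβ [cf. Proposition 1.5, (iii)] on both sides» (p. 25 l. 15–19), typed as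
`γ ∘ ια = ιβ ∘ γ`.

* `ThetaSetting.ThetaCompanion.thetaIso_comp_of_compat` — companions compose compatibly (they are rigid: the
  squares `(·)^Θ ∘ γ = γ^Θ ∘ (·)^Θ` and the surjectivity of `(·)^Θ`);
* `ThetaSetting.transport_comm_of_compat` — `transport(ιβ) ∘ transport(γ) = transport(γ) ∘ transport(ια)` on
  `H¹(Π^tp_Ÿ, Δ_Θ)`;
* `ThetaSetting.hιx_of_invClauses` — the capstone binder `hιx` («ιβ fixes, up to O^×_{K̈β}, every Θ-lift of
  γ(η̈^Θ_α)») from clause (1) of Prop. 1.5 (iii) on the α side + compatibility + «units go to units» (Thm 1.6 (ii));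
* `ThetaSetting.hιy_of_invClauses` — the binder `hιy` for `σ ∈ Π^tp_{Ÿβ}` from clause (1) on the β side;
* `Thm16Sub.thm16iii_of_inversionClauses` — [EtTh] Thm. 1.6 (iii) with the rows L12/L14-ι and `htf` consumed from
  the ROOT predicates: what stays print-shaped is the compatibility clause ([SemiAnbd] Thm. 6.8 (ii), layer L3),
  «Δ_Θ has no 2-torsion» («Δ_Θ ≅ Ẑ(1)», p. 12) and the cusp evaluations (Prop. 1.4 (iii), cusp clause — G-K3-3).
HONEST FRAMING: [EtTh] is refereed; nothing here bears on [IUTchIII] Cor. 3.12; typed ≠ proved; no side taken.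
-/

noncomputable section

namespace Literature.AnabelianGeometry.EtaleTheta

open Literature.AnabelianGeometry.SemiGraphs

namespace ThetaSetting

variable {p : ℕ} [Fact p.Prime] {Dα Dβ : ThetaSetting p} {γ : Dα.PiTemp ≃ₜ* Dβ.PiTemp}
  {ια : Dα.PiTemp ≃ₜ* Dα.PiTemp} {ιβ : Dβ.PiTemp ≃ₜ* Dβ.PiTemp}

/-! ### Compatible inversion automorphisms: companions and transports commute -/

/-- From `γ ∘ ια = ιβ ∘ γ`: `γ⁻¹ ∘ ιβ⁻¹ = ια⁻¹ ∘ γ⁻¹`. [cite: MochizukiEtTh2009, Thm 1.6 (iii) p.25] -/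
theorem symm_symm_of_compat
    (hcompat : ∀ g, γ.toMulEquiv (ια.toMulEquiv g) = ιβ.toMulEquiv (γ.toMulEquiv g)) (y : Dβ.PiTemp) :
    γ.toMulEquiv.symm (ιβ.toMulEquiv.symm y) = ια.toMulEquiv.symm (γ.toMulEquiv.symm y) := by
  apply γ.toMulEquiv.injective
  apply ιβ.toMulEquiv.injective
  rw [MulEquiv.apply_symm_apply, MulEquiv.apply_symm_apply, ← hcompat, MulEquiv.apply_symm_apply,
    MulEquiv.apply_symm_apply]

/-- **Theta companions of compatible automorphisms compose compatibly**: if `γ ∘ ια = ιβ ∘ γ` on `Π^tp_X`, then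
`ιβ^Θ ∘ γ^Θ = γ^Θ ∘ ια^Θ` on `(Π^tp_{Xα})^Θ` — for ANY companions (the companion square and the surjectivity of
`(·)^Θ` pin them down). [cite: MochizukiEtTh2009, Thm 1.6 (ii) p.24] -/
theorem ThetaCompanion.thetaIso_comp_of_compat (c : ThetaCompanion γ) (cα : ThetaCompanion ια)
    (cβ : ThetaCompanion ιβ)
    (hcompat : ∀ g, γ.toMulEquiv (ια.toMulEquiv g) = ιβ.toMulEquiv (γ.toMulEquiv g)) (y : Dα.GtpTheta) :
    cβ.thetaIso.toMulEquiv (c.thetaIso.toMulEquiv y) = c.thetaIso.toMulEquiv (cα.thetaIso.toMulEquiv y) := by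
  obtain ⟨x, rfl⟩ := Dα.toTheta_surjective y
  rw [← cα.comm, ← c.comm, ← c.comm, hcompat, cβ.comm]

/-- **Transports commute for compatible inversion automorphisms**: on `H¹(Π^tp_{Ÿα}, Δ_Θ)`,
`transport(ιβ) ∘ transport(γ) = transport(γ) ∘ transport(ια)` («the isomorphism Π^tp_{Ÿα} ⥲ Π^tp_{Ÿβ} is
compatible with … ια, ιβ», p. 25). [cite: MochizukiEtTh2009, Thm 1.6 (iii) p.25] -/
theorem transport_comm_of_compat (h : Thm16i γ) (c : ThetaCompanion γ) (hα : Thm16i ια) (cα : ThetaCompanion ια)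
    (hβ : Thm16i ιβ) (cβ : ThetaCompanion ιβ)
    (hcompat : ∀ g, γ.toMulEquiv (ια.toMulEquiv g) = ιβ.toMulEquiv (γ.toMulEquiv g))
    (x : Dα.H1 Dα.GtpYdd) :
    transport cβ hβ (transport c h x) = transport c h (transport cα hα x) := by
  obtain ⟨f, rfl⟩ := QuotientGroup.mk_surjective x
  change (QuotientGroup.mk (transportCocycle cβ hβ (transportCocycle c h f)) : Dβ.H1 Dβ.GtpYdd) =
    QuotientGroup.mk (transportCocycle c h (transportCocycle cα hα f))
  congr 1
  apply Subtype.ext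
  funext y
  apply Subtype.ext
  have L : ((((transportCocycle cβ hβ (transportCocycle c h f)).1 y) : Dβ.DeltaTheta) : Dβ.GtpTheta) =
      cβ.thetaIso.toMulEquiv (c.thetaIso.toMulEquiv (f.1 ⟨γ.toMulEquiv.symm (ιβ.toMulEquiv.symm y.1),
        symm_mem_GtpYdd h ⟨ιβ.toMulEquiv.symm y.1, symm_mem_GtpYdd hβ y⟩⟩).1) := rfl
  have R : ((((transportCocycle c h (transportCocycle cα hα f)).1 y) : Dβ.DeltaTheta) : Dβ.GtpTheta) =
      c.thetaIso.toMulEquiv (cα.thetaIso.toMulEquiv (f.1 ⟨ια.toMulEquiv.symm (γ.toMulEquiv.symm y.1),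
        symm_mem_GtpYdd hα ⟨γ.toMulEquiv.symm y.1, symm_mem_GtpYdd h y⟩⟩).1) := rfl
  rw [L, R]
  have harg : (⟨γ.toMulEquiv.symm (ιβ.toMulEquiv.symm y.1),
        symm_mem_GtpYdd h ⟨ιβ.toMulEquiv.symm y.1, symm_mem_GtpYdd hβ y⟩⟩ : Dα.GtpYdd) =
      ⟨ια.toMulEquiv.symm (γ.toMulEquiv.symm y.1),
        symm_mem_GtpYdd hα ⟨γ.toMulEquiv.symm y.1, symm_mem_GtpYdd h y⟩⟩ :=
    Subtype.ext (symm_symm_of_compat hcompat y.1)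
  rw [harg]
  exact ThetaCompanion.thetaIso_comp_of_compat c cα cβ hcompat _

/-! ### The capstone's inversion binders from Prop. 1.5 (iii) -/

/-- **The binder `hιx` of the K3 capstone from the ROOT ι-clause**: if `ια` fixes `O^×·η̈^Θ_α` (clause (1) of
Prop. 1.5 (iii) for `α`, `InvClauses`), `γ ∘ ια = ιβ ∘ γ`, and the transport along `γ` carries the unit classes of
`α` onto those of `β` (Thm. 1.6 (ii), K3 row L11 (b)), then the Θ-level action of `ιβ` fixes every lift of
`γ(η̈^Θ_α)` up to a unit: `T x′ = x′ · κ(u)`, `u ∈ O^×_{K̈β}`. [cite: MochizukiEtTh2009, Thm 1.6 (iii) p.25] -/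
theorem hιx_of_invClauses (h : Thm16i γ) (c : ThetaCompanion γ) {Eα : Dα.EtaleThetaData} {Eβ : Dβ.EtaleThetaData}
    (hια : Dα.IsInversionAut ια) (cα : ThetaCompanion ια) (hInvα : InvClauses Eα hια cα)
    (hιβ : Dβ.IsInversionAut ιβ) (cβ : ThetaCompanion ιβ)
    (hcompat : ∀ g, γ.toMulEquiv (ια.toMulEquiv g) = ιβ.toMulEquiv (γ.toMulEquiv g))
    (hunits : Eα.kumUnitsYdd.map (transport c h) = Eβ.kumUnitsYdd)
    (T : Dβ.H1Theta (Dβ.GtpYdd.map Dβ.toTheta) ≃* Dβ.H1Theta (Dβ.GtpYdd.map Dβ.toTheta))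
    (hT : ∀ z, Dβ.inflTheta Dβ.GtpYdd (T z) = transport cβ hιβ.thm16i (Dβ.inflTheta Dβ.GtpYdd z))
    (x' : Dβ.H1Theta (Dβ.GtpYdd.map Dβ.toTheta)) (hx' : Dβ.inflTheta Dβ.GtpYdd x' = transport c h Eα.etaDd) :
    ∃ u ∈ Dβ.unitsOKdd, T x' = x' * Eβ.kumYdd (Eβ.toKddHat u) := by
  -- clause (1) on the α side: `ια(η̈^Θ_α) = k · η̈^Θ_α`, `k` a unit class
  have hη : Eα.etaDd ∈ Eα.thetaClasses := ⟨1, Eα.kumUnitsYdd.one_mem, (one_mul _).symm⟩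
  obtain ⟨k, hk, hkη⟩ := hInvα.transport_mem hη
  -- its transport along `γ` is a unit class of `β`
  have hkβ : transport c h k ∈ Eβ.kumUnitsYdd := by
    rw [← hunits]
    exact ⟨k, hk, rfl⟩
  obtain ⟨cw, ⟨w, hw, rfl⟩, hcw⟩ := hkβ
  refine ⟨w, hw, ?_⟩
  apply Dβ.inflTheta_injective Dβ.GtpYdd
  rw [hT, hx', transport_comm_of_compat h c hια.thm16i cα hιβ.thm16i cβ hcompat, hkη, map_mul, map_mul, hx',
    mul_comm]
  exact congrArg (transport c h Eα.etaDd * ·) hcw.symm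

/-- **The binder `hιy` of the K3 capstone from the ROOT ι-clause on the β side**, for `σ ∈ Π^tp_{Ÿβ}` (in
particular `σ = 1`, print's situation after composing `γ` with an inner automorphism, p. 25 l. 15): the
Θ-level action of `ιβ` fixes every lift of `σ·η̈^Θ_β = η̈^Θ_β` up to a unit. [cite: MochizukiEtTh2009, Thm 1.6 (iii) p.25] -/
theorem hιy_of_invClauses {D : ThetaSetting p} (hC : D.Compat) {E : D.EtaleThetaData} {ι : D.PiTemp ≃ₜ* D.PiTemp}
    (hι : D.IsInversionAut ι) (cι : ThetaCompanion ι) (hInv : InvClauses E hι cι)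
    (T : D.H1Theta (D.GtpYdd.map D.toTheta) ≃* D.H1Theta (D.GtpYdd.map D.toTheta))
    (hT : ∀ z, D.inflTheta D.GtpYdd (T z) = transport cι hι.thm16i (D.inflTheta D.GtpYdd z))
    {σ : D.PiTemp} (hσ : σ ∈ D.GtpYdd)
    (y' : D.H1Theta (D.GtpYdd.map D.toTheta))
    (hy' : haveI := hC.GtpYdd_normal
      D.inflTheta D.GtpYdd y' = ContH1.conj D.toTheta D.DeltaTheta σ E.etaDd) :
    ∃ u ∈ D.unitsOKdd, T y' = y' * E.kumYdd (E.toKddHat u) := by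
  haveI := hC.GtpYdd_normal
  rw [ContH1.conj_eq_self_of_mem σ hσ] at hy'
  have hη : E.etaDd ∈ E.thetaClasses := ⟨1, E.kumUnitsYdd.one_mem, (one_mul _).symm⟩
  obtain ⟨u, hu, -, -, -, hTu⟩ := hInv.thetaLift_fixed T hT hη y' hy'
  exact ⟨u, hu, hTu⟩

end ThetaSetting

/-! ### [EtTh] Thm. 1.6 (iii) with the inversion rows consumed from the root predicates -/

namespace Thm16Sub

variable {p : ℕ} [Fact p.Prime] {Dα Dβ : ThetaSetting p} {γ : Dα.PiTemp ≃ₜ* Dβ.PiTemp}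

/-- **[EtTh] Theorem 1.6 (iii), rows L12/L14-ι and «F̈¹/F̈² ≅ Ẑ» from the ROOT**: as abc-iut-L6-d5's
`thm16iii_of_printedClauses`, with the inversion action and its clauses (`ι`, `hιF1`, `hιx`, `hιy`) and `htf`
REPLACED by: inversion automorphisms `ια`, `ιβ` of `Π^tp_{Xα}`, `Π^tp_{Xβ}` (`ThetaSetting.IsInversionAut`) with
theta companions, COMPATIBLE with `γ` (p. 25 l. 15–19; [SemiAnbd] Thm. 6.8 (ii) after an inner adjustment of `γ`),
satisfying Prop. 1.5 (iii)'s clause (`InvClauses`, both sides) and acting by `−1` on `F̈¹/F̈²`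
(`InvNegatesFdd1Quot`, β side), the identification `F̈¹/F̈² = Ẑ·log(Ü)` (`Prop15iiQuot`, β side) and «Δ_Θ has no
2-torsion»; `σ ∈ Π^tp_{Ÿβ}` (e.g. `σ = 1`). [cite: MochizukiEtTh2009, Thm 1.6 (iii) p.25] -/
theorem thm16iii_of_inversionClauses (h : ThetaSetting.Thm16i γ) (c : ThetaSetting.ThetaCompanion γ)
    (hΔ : Dα.DeltaTemp.map γ.toMulEquiv.toMonoidHom = Dβ.DeltaTemp)
    (Eα : Dα.EtaleThetaData) (Eβ : Dβ.EtaleThetaData) (hCα : Dα.Compat) (hCβ : Dβ.Compat)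
    (hSβ : Dβ.Sec2Hyps) (h15iiα : ThetaSetting.Prop15ii Eα.toKummerData hCα)
    (h15ii : ThetaSetting.Prop15ii Eβ.toKummerData hCβ)
    (h15α : ThetaSetting.Prop15iii Eα hCα) (h15β : ThetaSetting.Prop15iii Eβ hCβ)
    {σ : Dβ.PiTemp} (hσ : σ ∈ Dβ.GtpYdd)
    -- row L11 (b)(c): valuation data with the genuine kernel and the [AbsAnab] 1.2.1 clauses for the induced δ
    (Vα : ThetaSetting.ValuationHatData Dα Eα.toKummerData)
    (Vβ : ThetaSetting.ValuationHatData Dβ Eβ.toKummerData)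
    (hVα : Vα.unitsHat = Dα.unitsOKdd.map Eα.toKddHat) (hVβ : Vβ.unitsHat = Dβ.unitsOKdd.map Eβ.toKddHat)
    (hV : ∀ δ : Eα.KddHat ≃* Eβ.KddHat,
      (∀ a, ThetaSetting.transport c h (Dα.inflTheta Dα.GtpYdd (Eα.kumYdd a)) =
        Dβ.inflTheta Dβ.GtpYdd (Eβ.kumYdd (δ a))) → DeltaPreservesUnitsAndOne δ Vα Vβ)
    -- rows L12/L14-ι FROM THE ROOT: compatible inversion automorphisms with Prop. 1.5 (iii)'s clause
    {ια : Dα.PiTemp ≃ₜ* Dα.PiTemp} (hια : Dα.IsInversionAut ια) (cα : ThetaSetting.ThetaCompanion ια)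
    (hInvα : ThetaSetting.InvClauses Eα hια cα)
    {ιβ : Dβ.PiTemp ≃ₜ* Dβ.PiTemp} (hιβ : Dβ.IsInversionAut ιβ) (cβ : ThetaSetting.ThetaCompanion ιβ)
    (hInvβ : ThetaSetting.InvClauses Eβ hιβ cβ) (hneg : Dβ.InvNegatesFdd1Quot hCβ hιβ cβ)
    (hcompat : ∀ g, γ.toMulEquiv (ια.toMulEquiv g) = ιβ.toMulEquiv (γ.toMulEquiv g))
    -- «F̈¹/F̈² = Ẑ · log(Ü)» FROM THE ROOT, and «Δ_Θ ≅ Ẑ(1)» has no 2-torsion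
    (hquot : ThetaSetting.Prop15iiQuot Eβ.toKummerData hCβ) (h2 : ∀ t : Dβ.DeltaTheta, t * t = 1 → t = 1)
    -- row L15: the two cusp evaluations
    (y : ThetaSetting.CuspidalPointDd Eβ.toKummerData) {u₁ u₂ v₁ v₂ : (↥Dβ.Kdd)ˣ}
    (hu₁ : u₁ ∈ Dβ.unitsOKdd) (hu₂ : u₂ ∈ Dβ.unitsOKdd)
    (hv : ‖((v₁ : Dβ.Kdd) : PadicAlgCl p)‖ = ‖((v₂ : Dβ.Kdd) : PadicAlgCl p)‖)
    (h₁ : haveI := hCβ.GtpYdd_normal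
      y.evalAt (ContH1.res Dβ.toTheta Dβ.DeltaTheta (y.sec_le.trans y.Dpt_le)
        (ContH1.conj Dβ.toTheta Dβ.DeltaTheta σ Eβ.etaDd)) = Eβ.toKddHat (u₁ * v₁))
    (h₂ : y.evalAt (ContH1.res Dβ.toTheta Dβ.DeltaTheta (y.sec_le.trans y.Dpt_le)
        (ThetaSetting.transport c h Eα.etaDd)) = Eβ.toKddHat (u₂ * v₂)) :
    ThetaSetting.Thm16iii γ h c Eα Eβ hCβ := by
  -- row L11 (a)(b): the induced δ and «units go to units» (parts 9, 6, (C)), as in the capstone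
  obtain ⟨δ, hδ⟩ := exists_delta_of_transportPreservesFdd2 c h Eα.toKummerData Eβ.toKummerData
    (transportPreservesFdd2_of_prop15ii h c hΔ Eα.toKummerData Eβ.toKummerData hCα hCβ h15iiα h15ii)
  have hunits := kumUnitsYdd_map_transport_eq_of_unitsHat h c Eα.toKummerData Eβ.toKummerData Vα Vβ
    hVα hVβ δ hδ (hV δ hδ).1
  -- the Θ-level action of `ιβ` (part 10)
  obtain ⟨T, hT⟩ := exists_thetaTransportEquiv hιβ.thm16i cβ
  exact thm16iii_of_printedClauses h c hΔ Eα Eβ hCα hCβ hSβ h15iiα h15ii h15α h15β σ Vα Vβ hVα hVβ hV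
    T (hneg T hT)
    (ThetaSetting.hιx_of_invClauses h c hια cα hInvα hιβ cβ hcompat hunits T hT)
    (ThetaSetting.hιy_of_invClauses hCβ hιβ cβ hInvβ T hT hσ)
    (fun d hd hsq => hquot.mem_Fdd2_of_sq_mem h2 hd hsq)
    y hu₁ hu₂ hv h₁ h₂

end Thm16Sub

end Literature.AnabelianGeometry.EtaleTheta

end
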